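import Literature.MathematicalPhysics.QuantumFieldTheory.Balaban1983to89.B9Ineq346L2RightDiff
import Literature.MathematicalPhysics.QuantumFieldTheory.Balaban1983to89.B9Eq382V3Letters
import Literature.MathematicalPhysics.QuantumFieldTheory.Balaban1983to89.B9Eq373CurvComm

/-!
# `Balaban1983to89.B9Ineq385V3RightKernel` — [Balaban1985BackgroundPropagators] p. 407 (3.84)–(3.86) «the remainders … G(U′U)V(A)G(U) …»
# read with `V₃(A)` ON THE RIGHT of a kernel-bounded operator: THE COLUMNS (`ℓ¹` block bounds) OF THE CONCRETE LOCAL PERTURBATION `V₃(A)` OF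
# (3.82) AND THE KERNEL BOUND OF `X·V₃(A)` — the `V₃`-part of the transposed twin of `B9Ineq385KernelConcrete.ineq385_kernel_concreteV₃`
# (there: `V(A)` on the LEFT of `G`), i.e. the G-side analogue of FILE 41 §3 (`B9Ineq346L2RightDiff.hasKernelBound_mul_vPrime_right`);
# FILE 42 of the Sect. B programme of cell `lit-balaban`, seat r06 gen 19 — first input of the `L²` member (3.46)₆ for `G(U′U)`

statement-level skeleton of published theorems with citation tags; proofs where landed; nothing here is a claim about the Yang–Mills mass gap

CITATION HEADER (lean-in-tree rule).  B9 = T. Bałaban, *Propagators for lattice gauge theories in a background field*, Commun. Math. Phys. **99** (1985)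
389–434 [Balaban1985BackgroundPropagators] (doi 10.1007/bf01240355; `paper:balaban1985-cmp99-background-propagators`, journal page = PDF page + 388):
p. 407 [PDF 19] (3.82) «Δ_a(U′U) = … = Δ_a(U) − V₃(A) − P₁(A) − P₂(A)» with «The operator V₃(A) is a local differential operator of the first order
satisfying the bound (3.73)», (3.73) p. 405 «|V(A)g| ≦ O(1)α₁((Lʲη)⁻¹|∇g| + (Lʲη)⁻²|g|)»-type sizes, (3.84)–(3.86) p. 407 (the resolvent expansion of
`G(U′U)` and «the remainders … satisfy Theorem 3.3 with the additional small factor O(1)α₁», p. 403 l. 7–9 for the wording), Theorem 3.3 p. 399 /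
Theorem 3.1 (3.42) p. 397 (the kernel entries `G`, `G∇*` the right letter multiplies), p. 398 [PDF 10] L20–24 remark («the choice of powers Lʲη is
conventional also. Using Lemma 2.1 in [4] we may replace the factor (Lʲη)^α by (Lʲη)^β(L^{j′}η)^γ with β + γ = α»), (3.35)/(3.37) p. 396 (the sizes of
`U(∂p) − 1` and of the exponent field), p. 404 after (3.69) and (3.71)/(3.75) pp. 404–405 (the stencils `st(b)` of the local letters).  [4] = B6 =
T. Bałaban, *Propagators and renormalization transformations for lattice gauge theories. II*, Commun. Math. Phys. **96** (1984) 223–250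
[Balaban1984PropagatorsII]: (2.51)–(2.55) p. 232 (block majorants of letters and of products, «insert Σ_{y″}Δ(y″) = I»), Lemma 2.1 (2.60)–(2.61) p. 234,
(2.64)–(2.66) p. 234 (the kernel shape `K(y,y′)(L^{j′}η)^{−d}`).  The COLUMN reading (ℓ¹ mass of a column inside a block) of (2.51) and the
device «majorant + locality ⟹ column» are this lineage's bookkeeping (the print treats these members as «routine», p. 407 one sentence).

WHAT THIS FILE PROVES (theorems only; no `def`, no `sorry`, no new named fact).
* §1 `col_conj_of_hasMajorant_local` — THE BRIDGE: a real-coordinate letter `conj b L` with a block MAJORANT `K(y,y′)` ([4] (2.51)) whose `E`-valued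
  letter `L` is LOCAL («(LF)(b) depends on F only through the bonds over the sites of a stencil N(x_b)», the typed content of «local operator», with
  a symmetric stencil of `≦ n` sites) has COLUMNS of `ℓ¹`-mass `≦ (#κ·n·#ι)·K(y″,y′)` in the block `Δ(y″)` — because the majorant bounds every
  ENTRY (test function `δ_{z′}`) and locality bounds the NUMBER of non-zero entries of a column; `nbhd₁_*`/`nbhd₂_*`: the concrete two-step
  translation stencils (sites `x`, `x ± e_a`, `x ± e_a ± e_b`) are symmetric with `≦ (2#κ+1)²` sites.
* §2 LOCALITY of the concrete letters at the `𝔸`-valued level: the covariant bond differences `∇_k` (`loc_diffLetter`), the first-order coefficient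
  letters `V¹_k = V1Letter k + V1Letter₂ k` of (3.71)/(3.75) (`loc_V1`), the whole `V₃(A)` (`loc_V₃Op`, from `B9Eq373V3.V₃val_congr`: «depends on A′
  only through st(b) ∪ locBonds₂(b)»), products (`loc_mul`) and the zeroth-order REMAINDER OF THE DIVERGENCE FORM
  `C″ = V₃(A) − Σ_k ∇_k V¹_k` (`loc_Cpp`).
* §3 COLUMNS: `col_V1` (`V¹_k`: `O(1)α₁(Lʲη)⁻¹e^{−δd}`, from `B9Eq382V3Letters.hasMajorant_V₃_one`) and `col_Cpp` (`C″ = V⁰ + Σ_k[V¹_k, ∇_k]`: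
  `O(1)α₁(Lʲη)⁻²e^{−δd}`, from `hasMajorant_V₃_zero` + `B9Eq373CurvComm.hasMajorant_comm_V₃_one` through `B9Ineq386CommSum.hasMajorant_C₃_of_comm_sum`).
* §4 **`hasKernelBound_mul_V₃_right`**: for an operator `X` on the bond carrier with KERNEL bounds for `X` (weight `w_X`) and for its right entries
  `X·∇_k` (weight `w_X(Lʲη)⁻¹`) — print: `X = G(U′U)`, Theorem 3.3's (3.42)₁,₃ for the extended operator — the kernel bound
  `|(X·V₃(A))(x,x′)| ≦ Θ·α₁·w_X(y)(Lʲη)⁻²·e^{−ρd(y,y′)}·(v(y′))⁻¹` with an explicit `Θ` («O(1)B₀α₁»), via `X·V₃ = Σ_k(X∇_k)·V¹_k + X·C″` and FILE 41's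
  «kernel × column ⟹ kernel» (`B9Ineq346L2RightDiff.hasKernelBound_mul_col`, scale transfers of `(Lʲη)⁻¹`, `(Lʲη)⁻²`, of `v⁻¹`, and [4] (2.61)).

HONEST SCOPE / NOT CLAIMED.  (i) Only the LOCAL part `V₃(A)` of `V(A) = V₃ + P₁ + P₂` ((3.84)) is treated; the right forms of `P₁(A)`, `P₂(A)` and
the `L²` member (3.46)₆ for `G(U′U)` itself are successor files.  (ii) Group-valued background (`‖U^{±1}‖ ≦ 1`), commuting translations, `η = g.eta`,
(3.35) in the two plaquette shapes the cited majorant files read it, (3.37) blockwise in their shapes; the stencil system `N₁ ⊆ N` is a PARAMETER with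
its closure/symmetry/cardinality properties as hypotheses (§1 provides the concrete instance).  (iii) Constants explicit but not optimised; they depend
on `d = #κ`, `#ι`, `M₂Σ‖b_i‖`, `C₀`, the stencil count `n` and the transfer constants only — never on the lattice.  (iv) Block-calculus typing of the
lineage ([4] (2.51)/(2.64) shapes `HasMajorant`/`HasKernelBound` on the real carrier `(κ × S) × ι`); NOT summit progress.

RELATED IN THE TREE, NOT DUPLICATED (searched 2026-08-23: `lean search --decl 'V3RightKernel|col_conj_of_hasMajorant|hasKernelBound_mul_V₃'` = ∅):
FILE 41 `B9Ineq346L2RightDiff` has the column calculus and the `V′(A)` (G′-side) letters by hand-made entry bounds; this file derives columns from the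
EXISTING majorants of the gen-11 `V₃` files plus locality, so no letter estimate is redone.
-/

noncomputable section

namespace Literature.MathematicalPhysics.QuantumFieldTheory.Balaban1983to89.B9Ineq385V3RightKernel

open NormedSpace Complex
open Literature.MathematicalPhysics.QuantumFieldTheory.Balaban1983to89
open Literature.MathematicalPhysics.QuantumFieldTheory.Balaban1983to89.B6RandomWalk (HasMajorant BlockSupp hasMajorant_mono hasMajorant_add Triangle254 Ineq261)
open Literature.MathematicalPhysics.QuantumFieldTheory.Balaban1983to89.B6RandomWalkKernel (HasKernelBound hasKernelBound_mono hasKernelBound_add)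
open Literature.MathematicalPhysics.QuantumFieldTheory.Balaban1983to89.B9Thm34Ext (toB6)
open Literature.MathematicalPhysics.QuantumFieldTheory.Balaban1983to89.B9Ineq347 (ScaleTransfer)
open Literature.MathematicalPhysics.QuantumFieldTheory.Balaban1983to89.Beta.BackgroundVertices (ad ad_apply)
open Literature.MathematicalPhysics.QuantumFieldTheory.Balaban1983to89.B9Eq39Adjoint
open Literature.MathematicalPhysics.QuantumFieldTheory.Balaban1983to89.B9Eq352DivForm (tauF tauB tauF_apply tauB_apply)
open Literature.MathematicalPhysics.QuantumFieldTheory.Balaban1983to89.B9Eq352DivFormLetters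
open Literature.MathematicalPhysics.QuantumFieldTheory.Balaban1983to89.B9Eq352GradLetters (coefLetter diffLetter coefLetter_inl coefLetter_inr
  diffLetter_inl diffLetter_inr conj_add conj_finset_sum)
open Literature.MathematicalPhysics.QuantumFieldTheory.Balaban1983to89.B9Eq371GradLetters (bT bU Ab bT_apply bT_symm_apply bU_apply Ab_apply
  mixLetterF mixLetterB mixLetterF_apply mixLetterB_apply V1Letter V1Letter_inl V1Letter_inr)
open Literature.MathematicalPhysics.QuantumFieldTheory.Balaban1983to89.B9Eq375GradLetters (mixLetterF₂ mixLetterB₂ mixLetterF₂_apply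
  mixLetterB₂_apply V1Letter₂ V1Letter₂_inl V1Letter₂_inr)
open Literature.MathematicalPhysics.QuantumFieldTheory.Balaban1983to89.B9Eq369Small (Through)
open Literature.MathematicalPhysics.QuantumFieldTheory.Balaban1983to89.B9Eq372Locality (stBonds pBonds mem_stBonds_iff)
open Literature.MathematicalPhysics.QuantumFieldTheory.Balaban1983to89.B9Eq375Locality (locBonds₂ dirBonds₂)
open Literature.MathematicalPhysics.QuantumFieldTheory.Balaban1983to89.B9Eq373V3 (V₃val V₃val_congr)
open Literature.MathematicalPhysics.QuantumFieldTheory.Balaban1983to89.B9Eq382V3Letters (V₃Op V₃Op_apply conj_V₃Op_eq_gradForm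
  hasMajorant_V₃_zero hasMajorant_V₃_one cV0)
open Literature.MathematicalPhysics.QuantumFieldTheory.Balaban1983to89.B9Eq373CurvComm (hasMajorant_comm_V₃_one)
open Literature.MathematicalPhysics.QuantumFieldTheory.Balaban1983to89.B9Ineq386CommSum (hasMajorant_C₃_of_comm_sum)
open Literature.MathematicalPhysics.QuantumFieldTheory.Balaban1983to89.B9Ineq346L2RightDiff (coordSymm_single hasKernelBound_mul_col
  hasKernelBound_finset_sum)

/-! ## §1  The bridge «block majorant + locality ⟹ column bound», and the concrete translation stencils -/

section Bridge

variable {E : Type*} [NormedAddCommGroup E] [NormedSpace ℝ E] {ι : Type} [Fintype ι] [DecidableEq ι] (b : Module.Basis ι ℝ E)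
variable {S : Type} [Fintype S] [DecidableEq S] {κ : Type} [Fintype κ] [DecidableEq κ]
variable {g : B9.Geometry} [Fintype g.Site] [DecidableEq g.Site] {Rr : ℝ} {H : Prop}

/-- **MAJORANT + LOCALITY ⟹ COLUMN.**  Let `L` be an `E`-valued letter on the bond carrier `κ × S` which is LOCAL with respect to a stencil of
sites `N` («(LF)(b) = 0 whenever F vanishes on the bonds over N(x_b)»), `N` symmetric with `≦ n` sites, and let `conj b L ≺ K` be a block majorant
([4] (2.51): `|(conj b L)μ(z)| ≦ K(y_z,y′)|μ|` for `supp μ ⊂ Δ(y′)`).  Then every ENTRY of `conj b L` is `≦ K` (test function `δ_{z′}`), the entries of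
the column `z′` vanish outside the bonds over `N(x_{z′})`, hence the column has `ℓ¹`-mass `≦ (#κ·n·#ι)·K(y″,y′)` in the block `Δ(y″)`.
[cite: Balaban1984PropagatorsII, (2.51)–(2.52) p.232; Balaban1985BackgroundPropagators, p.407 «local … operator» + (3.73) p.405 (bookkeeping ours)] -/
theorem col_conj_of_hasMajorant_local (blk : S → g.Site) (N : S → Finset S) (n : ℕ)
    (hsymm : ∀ z z' : S, z' ∈ N z → z ∈ N z') (hcard : ∀ z, (N z).card ≤ n)
    (L : Module.End ℝ (κ × S → E))
    (hloc : ∀ (F : κ × S → E) (q : κ × S), (∀ q' : κ × S, q'.2 ∈ N q.2 → F q' = 0) → L F q = 0)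
    {K : g.Site → g.Site → ℝ} (hK0 : ∀ a a', 0 ≤ K a a')
    (hK : HasMajorant (g := toB6 g Rr H) (fun z : (κ × S) × ι => blk z.1.2) (conj b L) K) :
    ∀ (z' : (κ × S) × ι) (y'' : g.Site),
      (∑ z ∈ Finset.univ.filter (fun z : (κ × S) × ι => blk z.1.2 = y''), |conj b L (Pi.single z' 1) z|) ≤
        (Fintype.card κ * n * Fintype.card ι : ℝ) * K y'' (blk z'.1.2) := by
  classical
  rintro ⟨q', i⟩ y''
  -- every entry is bounded by the majorant (test function `δ_{z′}`, `|δ| ≦ 1`, `supp δ ⊂ Δ(y′)`)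
  have hBS : BlockSupp (g := toB6 g Rr H) (fun z : (κ × S) × ι => blk z.1.2) (Pi.single (q', i) (1 : ℝ)) (blk q'.2) 1 := by
    refine ⟨zero_le_one, fun z _ => ?_, fun z hz => ?_⟩
    · by_cases h : z = (q', i)
      · subst h; simp
      · rw [Pi.single_eq_of_ne h]; simp
    · have h : z ≠ (q', i) := fun e => hz (by rw [e])
      exact Pi.single_eq_of_ne h _
  have hent : ∀ z : (κ × S) × ι, |conj b L (Pi.single (q', i) 1) z| ≤ K (blk z.1.2) (blk q'.2) := fun z => by
    simpa using hK (blk q'.2) (Pi.single (q', i) 1) 1 hBS z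
  -- the entries of the column vanish off the bonds over `N(x_{z′})`
  have hvan : ∀ z : (κ × S) × ι, z.1.2 ∉ N q'.2 → conj b L (Pi.single (q', i) 1) z = 0 := by
    intro z hz
    rw [conj_apply, coordSymm_single]
    have h0 : L (Pi.single q' (b i)) z.1 = 0 := by
      refine hloc _ z.1 fun q'' hq'' => ?_
      have hne : q'' ≠ q' := by
        rintro rfl
        exact hz (hsymm _ _ hq'')
      exact Pi.single_eq_of_ne hne _
    rw [h0, map_zero, Finsupp.zero_apply]
  -- count the possibly non-zero entries of the column inside `Δ(y″)`
  set F : Finset ((κ × S) × ι) := Finset.univ.filter (fun z : (κ × S) × ι => blk z.1.2 = y'') with hF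
  set P : Finset ((κ × S) × ι) := ((Finset.univ : Finset κ) ×ˢ N q'.2) ×ˢ (Finset.univ : Finset ι) with hP
  have hPcard : (P.card : ℝ) ≤ Fintype.card κ * n * Fintype.card ι := by
    rw [hP, Finset.card_product, Finset.card_product, Finset.card_univ, Finset.card_univ]
    have := hcard q'.2
    have h1 : ((Fintype.card κ * (N q'.2).card * Fintype.card ι : ℕ) : ℝ) ≤ Fintype.card κ * n * Fintype.card ι := by
      exact_mod_cast Nat.mul_le_mul_right _ (Nat.mul_le_mul_left _ this)
    exact_mod_cast h1
  have hKy : 0 ≤ K y'' (blk q'.2) := hK0 _ _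
  calc (∑ z ∈ F, |conj b L (Pi.single (q', i) 1) z|)
      = ∑ z ∈ F.filter (fun z => z.1.2 ∈ N q'.2), |conj b L (Pi.single (q', i) 1) z| := by
        rw [← Finset.sum_filter_add_sum_filter_not F (fun z => z.1.2 ∈ N q'.2)]
        rw [Finset.sum_eq_zero (s := F.filter (fun z => ¬ z.1.2 ∈ N q'.2)) fun z hz => by
          rw [hvan z (Finset.mem_filter.mp hz).2, abs_zero], add_zero]
    _ ≤ ∑ z ∈ F.filter (fun z => z.1.2 ∈ N q'.2), K y'' (blk q'.2) := by
        refine Finset.sum_le_sum fun z hz => ?_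
        have hzF := (Finset.mem_filter.mp (Finset.mem_filter.mp hz).1).2
        rw [← hzF]
        exact hent z
    _ = ((F.filter (fun z => z.1.2 ∈ N q'.2)).card : ℝ) * K y'' (blk q'.2) := by rw [Finset.sum_const, nsmul_eq_mul]
    _ ≤ (P.card : ℝ) * K y'' (blk q'.2) := by
        refine mul_le_mul_of_nonneg_right ?_ hKy
        exact_mod_cast Finset.card_le_card fun z hz => by
          rw [hP, Finset.mem_product, Finset.mem_product]
          exact ⟨⟨Finset.mem_univ _, (Finset.mem_filter.mp hz).2⟩, Finset.mem_univ _⟩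
    _ ≤ (Fintype.card κ * n * Fintype.card ι : ℝ) * K y'' (blk q'.2) := mul_le_mul_of_nonneg_right hPcard hKy

variable (T : κ → Equiv.Perm S)

omit [Fintype S] [DecidableEq κ] in
/-- The one-step translation stencil `N₁(z) = {z} ∪ {z + e_a} ∪ {z − e_a}` contains `z`.
[cite: Balaban1985BackgroundPropagators, p.404 after (3.69) + (3.71)/(3.75) pp.404–405 (the stencils of the local letters; bookkeeping ours)] -/
theorem nbhd₁_mem_self (z : S) :
    z ∈ insert z (Finset.univ.image (fun a => T a z) ∪ Finset.univ.image (fun a => (T a).symm z)) :=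
  Finset.mem_insert_self _ _

omit [Fintype S] [DecidableEq κ] in
/-- … contains `z + e_a`.
[cite: Balaban1985BackgroundPropagators, p.404 after (3.69) + (3.71)/(3.75) pp.404–405 (the stencils of the local letters; bookkeeping ours)] -/
theorem nbhd₁_mem_fwd (a : κ) (z : S) :
    T a z ∈ insert z (Finset.univ.image (fun a => T a z) ∪ Finset.univ.image (fun a => (T a).symm z)) :=
  Finset.mem_insert_of_mem (Finset.mem_union_left _ (Finset.mem_image.mpr ⟨a, Finset.mem_univ _, rfl⟩))

omit [Fintype S] [DecidableEq κ] in
/-- … contains `z − e_a`.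
[cite: Balaban1985BackgroundPropagators, p.404 after (3.69) + (3.71)/(3.75) pp.404–405 (the stencils of the local letters; bookkeeping ours)] -/
theorem nbhd₁_mem_bwd (a : κ) (z : S) :
    (T a).symm z ∈ insert z (Finset.univ.image (fun a => T a z) ∪ Finset.univ.image (fun a => (T a).symm z)) :=
  Finset.mem_insert_of_mem (Finset.mem_union_right _ (Finset.mem_image.mpr ⟨a, Finset.mem_univ _, rfl⟩))

omit [Fintype S] [DecidableEq κ] in
/-- … is symmetric.
[cite: Balaban1985BackgroundPropagators, p.404 after (3.69) + (3.71)/(3.75) pp.404–405 (the stencils of the local letters; bookkeeping ours)] -/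
theorem nbhd₁_symm (z z' : S)
    (h : z' ∈ insert z (Finset.univ.image (fun a => T a z) ∪ Finset.univ.image (fun a => (T a).symm z))) :
    z ∈ insert z' (Finset.univ.image (fun a => T a z') ∪ Finset.univ.image (fun a => (T a).symm z')) := by
  rcases Finset.mem_insert.mp h with rfl | h
  · exact Finset.mem_insert_self _ _
  · rcases Finset.mem_union.mp h with h | h
    · obtain ⟨a, -, rfl⟩ := Finset.mem_image.mp h
      refine Finset.mem_insert_of_mem (Finset.mem_union_right _ (Finset.mem_image.mpr ⟨a, Finset.mem_univ _, ?_⟩))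
      simp
    · obtain ⟨a, -, rfl⟩ := Finset.mem_image.mp h
      refine Finset.mem_insert_of_mem (Finset.mem_union_left _ (Finset.mem_image.mpr ⟨a, Finset.mem_univ _, ?_⟩))
      simp

omit [Fintype S] [DecidableEq κ] in
/-- … and has at most `2#κ + 1` sites.
[cite: Balaban1985BackgroundPropagators, p.404 after (3.69) + (3.71)/(3.75) pp.404–405 (the stencils of the local letters; bookkeeping ours)] -/
theorem nbhd₁_card (z : S) :
    (insert z (Finset.univ.image (fun a => T a z) ∪ Finset.univ.image (fun a => (T a).symm z))).card ≤ 2 * Fintype.card κ + 1 := by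
  refine (Finset.card_insert_le _ _).trans ?_
  refine Nat.add_le_add_right ((Finset.card_union_le _ _).trans ?_) 1
  have h1 := Finset.card_image_le (s := (Finset.univ : Finset κ)) (f := fun a => T a z)
  have h2 := Finset.card_image_le (s := (Finset.univ : Finset κ)) (f := fun a => (T a).symm z)
  rw [Finset.card_univ] at h1 h2
  omega

omit [Fintype S] [DecidableEq κ] in
/-- The two-step stencil `N(z) = ⋃_{z′∈N₁(z)} N₁(z′)` is closed under the composition of two steps.
[cite: Balaban1985BackgroundPropagators, p.404 after (3.69) + (3.71)/(3.75) pp.404–405 (the stencils of the local letters; bookkeeping ours)] -/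
theorem nbhd₂_comp (z z' z'' : S)
    (h₁ : z' ∈ insert z (Finset.univ.image (fun a => T a z) ∪ Finset.univ.image (fun a => (T a).symm z)))
    (h₂ : z'' ∈ insert z' (Finset.univ.image (fun a => T a z') ∪ Finset.univ.image (fun a => (T a).symm z'))) :
    z'' ∈ (insert z (Finset.univ.image (fun a => T a z) ∪ Finset.univ.image (fun a => (T a).symm z))).biUnion
      (fun w => insert w (Finset.univ.image (fun a => T a w) ∪ Finset.univ.image (fun a => (T a).symm w))) :=
  Finset.mem_biUnion.mpr ⟨z', h₁, h₂⟩

omit [Fintype S] [DecidableEq κ] in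
/-- … is symmetric.
[cite: Balaban1985BackgroundPropagators, p.404 after (3.69) + (3.71)/(3.75) pp.404–405 (the stencils of the local letters; bookkeeping ours)] -/
theorem nbhd₂_symm (z z'' : S)
    (h : z'' ∈ (insert z (Finset.univ.image (fun a => T a z) ∪ Finset.univ.image (fun a => (T a).symm z))).biUnion
      (fun w => insert w (Finset.univ.image (fun a => T a w) ∪ Finset.univ.image (fun a => (T a).symm w)))) :
    z ∈ (insert z'' (Finset.univ.image (fun a => T a z'') ∪ Finset.univ.image (fun a => (T a).symm z''))).biUnion
      (fun w => insert w (Finset.univ.image (fun a => T a w) ∪ Finset.univ.image (fun a => (T a).symm w))) := by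
  obtain ⟨z', h₁, h₂⟩ := Finset.mem_biUnion.mp h
  exact Finset.mem_biUnion.mpr ⟨z', nbhd₁_symm T _ _ h₂, nbhd₁_symm T _ _ h₁⟩

omit [Fintype S] [DecidableEq κ] in
/-- … and has at most `(2#κ + 1)²` sites.
[cite: Balaban1985BackgroundPropagators, p.404 after (3.69) + (3.71)/(3.75) pp.404–405 (the stencils of the local letters; bookkeeping ours)] -/
theorem nbhd₂_card (z : S) :
    ((insert z (Finset.univ.image (fun a => T a z) ∪ Finset.univ.image (fun a => (T a).symm z))).biUnion
      (fun w => insert w (Finset.univ.image (fun a => T a w) ∪ Finset.univ.image (fun a => (T a).symm w)))).card ≤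
      (2 * Fintype.card κ + 1) ^ 2 := by
  refine Finset.card_biUnion_le.trans ?_
  calc ∑ w ∈ insert z (Finset.univ.image (fun a => T a z) ∪ Finset.univ.image (fun a => (T a).symm z)),
        (insert w (Finset.univ.image (fun a => T a w) ∪ Finset.univ.image (fun a => (T a).symm w))).card
      ≤ ∑ _w ∈ insert z (Finset.univ.image (fun a => T a z) ∪ Finset.univ.image (fun a => (T a).symm z)), (2 * Fintype.card κ + 1) :=
        Finset.sum_le_sum fun w _ => nbhd₁_card T w
    _ ≤ (2 * Fintype.card κ + 1) ^ 2 := by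
        rw [Finset.sum_const, smul_eq_mul, pow_two]
        exact Nat.mul_le_mul_right _ (nbhd₁_card T z)

end Bridge

/-! ## §2  Locality of the concrete letters of `V₃(A)` (𝔸-valued level) -/

section LocalE

variable {𝔸 : Type*} [NormedRing 𝔸] [NormedAlgebra ℂ 𝔸] {S : Type} {κ : Type} [Fintype κ] [DecidableEq κ]
variable (T : κ → Equiv.Perm S) (U : κ → S → 𝔸ˣ) (A : κ → S → 𝔸)

omit [Fintype κ] [DecidableEq κ] in
/-- Locality passes to a larger stencil. [cite: Balaban1984PropagatorsII, (2.52) p.232 (bookkeeping ours)] -/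
theorem loc_mono {N₁ N : S → Finset S} (hsub : ∀ z z', z' ∈ N₁ z → z' ∈ N z) {L : Module.End ℝ (κ × S → 𝔸)}
    (h : ∀ (F : κ × S → 𝔸) (q : κ × S), (∀ q' : κ × S, q'.2 ∈ N₁ q.2 → F q' = 0) → L F q = 0) :
    ∀ (F : κ × S → 𝔸) (q : κ × S), (∀ q' : κ × S, q'.2 ∈ N q.2 → F q' = 0) → L F q = 0 :=
  fun F q hF => h F q fun q' hq' => hF q' (hsub _ _ hq')

omit [Fintype κ] [DecidableEq κ] in
/-- **Locality of a product** ([4] (2.52) «compositions of letters», stencils compose): `L₁`, `L₂` local for the one-step stencil `N₁` ⟹ `L₁L₂` local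
for any `N ⊇ N₁∘N₁`. [cite: Balaban1984PropagatorsII, (2.52) p.232 (bookkeeping ours)] -/
theorem loc_mul {N₁ N : S → Finset S} (hN : ∀ z z' z'', z' ∈ N₁ z → z'' ∈ N₁ z' → z'' ∈ N z)
    {L₁ L₂ : Module.End ℝ (κ × S → 𝔸)}
    (h₁ : ∀ (F : κ × S → 𝔸) (q : κ × S), (∀ q' : κ × S, q'.2 ∈ N₁ q.2 → F q' = 0) → L₁ F q = 0)
    (h₂ : ∀ (F : κ × S → 𝔸) (q : κ × S), (∀ q' : κ × S, q'.2 ∈ N₁ q.2 → F q' = 0) → L₂ F q = 0) :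
    ∀ (F : κ × S → 𝔸) (q : κ × S), (∀ q' : κ × S, q'.2 ∈ N q.2 → F q' = 0) → (L₁ * L₂) F q = 0 := by
  intro F q hF
  rw [Module.End.mul_apply]
  exact h₁ _ q fun q' hq' => h₂ F q' fun q'' hq'' => hF q'' (hN _ _ _ hq' hq'')

omit [Fintype κ] [DecidableEq κ] T U A in
/-- The multiplication letter `iad_{a(b)}` reads `F` at `b` only. [cite: Balaban1985BackgroundPropagators, (3.71) p.405 (term 4)] -/
theorem loc_mulLetter (M : S → Finset S) (hM0 : ∀ z, z ∈ M z) (a : κ × S → 𝔸) :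
    ∀ (F : κ × S → 𝔸) (q : κ × S), (∀ q' : κ × S, q'.2 ∈ M q.2 → F q' = 0) → mulLetter a F q = 0 := by
  intro F q hF
  rw [mulLetter_apply, hF q (hM0 _)]
  simp

omit [Fintype κ] [DecidableEq κ] A in
/-- **The covariant bond differences `∇_k` are local**: `(∇_{inl a}F)(μ,x)` reads `F(μ,x)`, `F(μ,x+e_a)`; `(∇_{inr a}F)(μ,x)` reads `F(μ,x)`,
`F(μ,x−e_a)`. [cite: Balaban1985BackgroundPropagators, (3.3) p.390 + (3.8) p.392] -/
theorem loc_diffLetter (M : S → Finset S) (hM0 : ∀ z, z ∈ M z) (hMF : ∀ a z, T a z ∈ M z) (hMB : ∀ a z, (T a).symm z ∈ M z)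
    (c : ℂ) (k : κ ⊕ κ) :
    ∀ (F : κ × S → 𝔸) (q : κ × S), (∀ q' : κ × S, q'.2 ∈ M q.2 → F q' = 0) → diffLetter (bT T) (bU U) c k F q = 0 := by
  intro F q hF
  cases k with
  | inl a =>
    rw [diffLetter_inl, gradLetterF_apply]
    simp only [covD, bT_apply, bU_apply]
    rw [hF (q.1, T a q.2) (hMF a q.2), hF q (hM0 _)]
    simp
  | inr a =>
    rw [diffLetter_inr, LinearMap.neg_apply, Pi.neg_apply, gradLetterB_apply]
    simp only [covDstar, bT_symm_apply, bU_apply]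
    rw [hF (q.1, (T a).symm q.2) (hMB a q.2), hF q (hM0 _)]
    simp

omit [DecidableEq κ] in
/-- The forward mixing letter of (3.71) reads `F(ν,x)`, `F(ν,x−e_ν)`. [cite: Balaban1985BackgroundPropagators, (3.71) pp.404–405] -/
theorem loc_mixLetterF [DecidableEq κ] (M : S → Finset S) (hM0 : ∀ z, z ∈ M z) (hMB : ∀ a z, (T a).symm z ∈ M z) (k₀ : κ) :
    ∀ (F : κ × S → 𝔸) (q : κ × S), (∀ q' : κ × S, q'.2 ∈ M q.2 → F q' = 0) → mixLetterF T U A k₀ F q = 0 := by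
  intro F q hF
  have h1 : ∀ ν, F (ν, (T ν).symm q.2) = 0 := fun ν => hF _ (hMB ν q.2)
  have h2 : ∀ ν, F (ν, q.2) = 0 := fun ν => hF (ν, q.2) (hM0 _)
  rw [mixLetterF_apply]
  refine smul_eq_zero_of_right _ (Finset.sum_eq_zero fun ν _ => ?_)
  simp [tauB_apply, h1, h2]

omit [Fintype κ] [DecidableEq κ] T U in
/-- The backward mixing letter of (3.71) reads `F(k₀,x)`. [cite: Balaban1985BackgroundPropagators, (3.71) pp.404–405] -/
theorem loc_mixLetterB (M : S → Finset S) (hM0 : ∀ z, z ∈ M z) (k₀ : κ) :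
    ∀ (F : κ × S → 𝔸) (q : κ × S), (∀ q' : κ × S, q'.2 ∈ M q.2 → F q' = 0) → mixLetterB A k₀ F q = 0 := by
  intro F q hF
  rw [mixLetterB_apply, hF (k₀, q.2) (hM0 _)]
  simp

omit T U in
/-- The forward mixing letter of (3.75) reads `F(ν,x)`. [cite: Balaban1985BackgroundPropagators, (3.75) p.405] -/
theorem loc_mixLetterF₂ (M : S → Finset S) (hM0 : ∀ z, z ∈ M z) (k₀ : κ) :
    ∀ (F : κ × S → 𝔸) (q : κ × S), (∀ q' : κ × S, q'.2 ∈ M q.2 → F q' = 0) → mixLetterF₂ A k₀ F q = 0 := by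
  intro F q hF
  have h2 : ∀ ν, F (ν, q.2) = 0 := fun ν => hF (ν, q.2) (hM0 _)
  rw [mixLetterF₂_apply]
  refine smul_eq_zero_of_right _ (Finset.sum_eq_zero fun ν _ => ?_)
  simp [h2]

omit [Fintype κ] [DecidableEq κ] in
/-- The backward mixing letter of (3.75) reads `F(k₀,x)`, `F(k₀,x+e_μ)`. [cite: Balaban1985BackgroundPropagators, (3.75) p.405] -/
theorem loc_mixLetterB₂ (M : S → Finset S) (hM0 : ∀ z, z ∈ M z) (hMF : ∀ a z, T a z ∈ M z) (k₀ : κ) :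
    ∀ (F : κ × S → 𝔸) (q : κ × S), (∀ q' : κ × S, q'.2 ∈ M q.2 → F q' = 0) → mixLetterB₂ T U A k₀ F q = 0 := by
  intro F q hF
  have h1 : F (k₀, T q.1 q.2) = 0 := hF _ (hMF q.1 q.2)
  have h2 : F (k₀, q.2) = 0 := hF (k₀, q.2) (hM0 _)
  rw [mixLetterB₂_apply, tauF_apply]
  simp [h1, h2]

/-- **The first-order coefficient letters `V¹_k = V1Letter k + V1Letter₂ k` of (3.71)/(3.75) are local** for the one-step stencil (sites `x`,
`x ± e_a`). [cite: Balaban1985BackgroundPropagators, (3.71) pp.404–405 + (3.75) p.405 + (3.73) p.405] -/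
theorem loc_V1 (M : S → Finset S) (hM0 : ∀ z, z ∈ M z) (hMF : ∀ a z, T a z ∈ M z) (hMB : ∀ a z, (T a).symm z ∈ M z) (k : κ ⊕ κ) :
    ∀ (F : κ × S → 𝔸) (q : κ × S), (∀ q' : κ × S, q'.2 ∈ M q.2 → F q' = 0) → (V1Letter T U A k + V1Letter₂ T U A k) F q = 0 := by
  intro F q hF
  rw [LinearMap.add_apply, Pi.add_apply]
  cases k with
  | inl k₀ =>
    rw [V1Letter_inl, V1Letter₂_inl, LinearMap.add_apply, Pi.add_apply, coefLetter_inl, loc_mulLetter M hM0 _ F q hF,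
      loc_mixLetterF T U A M hM0 hMB k₀ F q hF, loc_mixLetterF₂ A M hM0 k₀ F q hF]
    simp
  | inr k₀ =>
    rw [V1Letter_inr, V1Letter₂_inr, LinearMap.add_apply, Pi.add_apply, coefLetter_inr, loc_mulLetter M hM0 _ F q hF,
      loc_mixLetterB A M hM0 k₀ F q hF, loc_mixLetterB₂ T U A M hM0 hMF k₀ F q hF]
    simp

variable [CompleteSpace 𝔸] [LinearOrder κ]

omit [DecidableEq κ] in
/-- **`V₃(A)` IS LOCAL** (p. 407 «The operator V₃(A) is a local differential operator»): `(V₃(A)F)(b)` vanishes when `F` vanishes on the bonds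
over the two-step stencil of `x_b` — `B9Eq373V3.V₃val_congr` («depends on A′ only through st(b) ∪ locBonds₂(b)») with the sites of `st(b)`
(`mem_stBonds_iff`: boundary bonds of the plaquettes through `b`) and of `locBonds₂(b)` inside `N(x)`.
[cite: Balaban1985BackgroundPropagators, p.407 after (3.82) + p.404 after (3.69) + (3.75) p.405] -/
theorem loc_V₃Op {η : ℝ} (hη : η ≠ 0) {N₁ N : S → Finset S}
    (hN₁0 : ∀ z, z ∈ N₁ z) (hN₁F : ∀ a z, T a z ∈ N₁ z) (hN₁B : ∀ a z, (T a).symm z ∈ N₁ z)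
    (hN : ∀ z z' z'', z' ∈ N₁ z → z'' ∈ N₁ z' → z'' ∈ N z) :
    ∀ (F : κ × S → 𝔸) (q : κ × S), (∀ q' : κ × S, q'.2 ∈ N q.2 → F q' = 0) → V₃Op T U η A F q = 0 := by
  rintro F ⟨μ, x⟩ hF
  -- every bond of `st(b) ∪ locBonds₂(b)` lies over a site of `N(x)`
  have hsite : ∀ (k : κ) (z : S), (k, z) ∈ stBonds T μ x ∪ locBonds₂ T μ x → z ∈ N x := by
    rintro k z (h | h)
    · obtain ⟨a, c, y, hth, hq⟩ := mem_stBonds_iff.mp h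
      have hy : y ∈ N₁ x := by
        rcases hth.2 with ⟨-, hy | hy⟩ | ⟨-, hy | hy⟩ <;> rw [hy]
        · exact hN₁0 _
        · exact hN₁B _ _
        · exact hN₁0 _
        · exact hN₁B _ _
      simp only [pBonds, Set.mem_insert_iff, Set.mem_singleton_iff, Prod.mk.injEq] at hq
      rcases hq with ⟨-, hz⟩ | ⟨-, hz⟩ | ⟨-, hz⟩ | ⟨-, hz⟩ <;> rw [hz]
      · exact hN _ _ _ hy (hN₁0 _)
      · exact hN _ _ _ hy (hN₁F _ _)
      · exact hN _ _ _ hy (hN₁F _ _)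
      · exact hN _ _ _ hy (hN₁0 _)
    · simp only [locBonds₂, dirBonds₂, Set.mem_iUnion, Set.mem_insert_iff, Set.mem_singleton_iff, Prod.mk.injEq] at h
      obtain ⟨ν, h⟩ := h
      rcases h with ⟨-, hz⟩ | ⟨-, hz⟩ | ⟨-, hz⟩ | ⟨-, hz⟩ | ⟨-, hz⟩ <;> rw [hz]
      · exact hN _ _ _ (hN₁0 _) (hN₁0 _)
      · exact hN _ _ _ (hN₁0 _) (hN₁0 _)
      · exact hN _ _ _ (hN₁0 _) (hN₁F _ _)
      · exact hN _ _ _ (hN₁0 _) (hN₁B _ _)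
      · exact hN _ _ _ (hN₁F _ _) (hN₁B _ _)
  have hF' : ∀ (k : κ) (z : S), (k, z) ∈ stBonds T μ x ∪ locBonds₂ T μ x →
      (fun k z => F (k, z)) k z = (0 : κ → S → 𝔸) k z := fun k z h => hF (k, z) (hsite k z h)
  have h0 : V₃val T U η A (fun k z => (0 : κ × S → 𝔸) (k, z)) μ x = 0 := by
    rw [← V₃Op_apply T U hη A 0 μ x, map_zero]; rfl
  rw [V₃Op_apply T U hη, V₃val_congr T U η (A := A) (B := A) (A' := fun k z => F (k, z)) (B' := 0) (fun _ _ _ => rfl) hF']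
  exact h0

/-- **The zeroth-order remainder of the DIVERGENCE form, `C″ = V₃(A) − Σ_k ∇_kV¹_k`, is local** for the two-step stencil.
[cite: Balaban1985BackgroundPropagators, p.407 after (3.82) + (3.73) p.405; Balaban1984PropagatorsII, (2.52) p.232 (bookkeeping ours)] -/
theorem loc_Cpp {η : ℝ} (hη : η ≠ 0) {N₁ N : S → Finset S}
    (hN₁0 : ∀ z, z ∈ N₁ z) (hN₁F : ∀ a z, T a z ∈ N₁ z) (hN₁B : ∀ a z, (T a).symm z ∈ N₁ z)
    (hN : ∀ z z' z'', z' ∈ N₁ z → z'' ∈ N₁ z' → z'' ∈ N z) :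
    ∀ (F : κ × S → 𝔸) (q : κ × S), (∀ q' : κ × S, q'.2 ∈ N q.2 → F q' = 0) →
      (V₃Op T U η A - ∑ k : κ ⊕ κ, diffLetter (bT T) (bU U) ((η : ℂ)⁻¹) k * (V1Letter T U A k + V1Letter₂ T U A k)) F q = 0 := by
  intro F q hF
  rw [LinearMap.sub_apply, Pi.sub_apply, loc_V₃Op T U A hη hN₁0 hN₁F hN₁B hN F q hF, LinearMap.sum_apply, Finset.sum_apply,
    Finset.sum_eq_zero fun k _ => loc_mul (hN := hN) (loc_diffLetter T U N₁ hN₁0 hN₁F hN₁B _ k) (loc_V1 T U A N₁ hN₁0 hN₁F hN₁B k) F q hF,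
    sub_zero]

end LocalE

/-! ## §3  The columns of `V¹_k` and of `C″ = V⁰ + Σ_k[V¹_k, ∇_k]` after real coordinates -/

section Columns

variable {𝔸 : Type*} [NormedRing 𝔸] [NormedAlgebra ℂ 𝔸] [CompleteSpace 𝔸] {ι : Type} [Fintype ι] [DecidableEq ι] (b : Module.Basis ι ℝ 𝔸)
variable {S : Type} [Fintype S] [DecidableEq S] {κ : Type} [Fintype κ] [LinearOrder κ]
variable (T : κ → Equiv.Perm S) (U : κ → S → 𝔸ˣ)
variable {g : B9.Geometry} [Fintype g.Site] [DecidableEq g.Site]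

omit [CompleteSpace 𝔸] in
/-- **COLUMN BOUND OF `V¹_k`** ((3.73) first-order size read entrywise): `Σ_{z∈Δ(y″)}|(V¹_kδ_{z′})(z)| ≦ (#κ·n·#ι)·14(d+1)M₂(Σ‖b_i‖)e^{δd₀}·α₁(Lʲ″η)⁻¹·
e^{−δd(y″,y′)}` — majorant `hasMajorant_V₃_one` + locality `loc_V1` through §1.
[cite: Balaban1985BackgroundPropagators, (3.73) p.405 + (3.71) pp.404–405 + (3.75) p.405 + (3.37) p.396; Balaban1984PropagatorsII, (2.51) p.232 (bookkeeping ours)] -/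
theorem col_V1 (blk : S → g.Site) (A : κ → S → 𝔸) (d₀ δ M₂ α₁ : ℝ) (N₁ N : S → Finset S) (n : ℕ)
    (hN₁0 : ∀ z, z ∈ N₁ z) (hN₁F : ∀ a z, T a z ∈ N₁ z) (hN₁B : ∀ a z, (T a).symm z ∈ N₁ z)
    (hN : ∀ z z' z'', z' ∈ N₁ z → z'' ∈ N₁ z' → z'' ∈ N z)
    (hsymm : ∀ z z' : S, z' ∈ N z → z ∈ N z') (hcard : ∀ z, (N z).card ≤ n)
    (hα₁ : 0 ≤ α₁) (hδ : 0 ≤ δ) (hM₂ : 0 ≤ M₂) (hrepr : ∀ (v : 𝔸) (i : ι), |b.repr v i| ≤ M₂ * ‖v‖)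
    (hlen : ∀ y : g.Site, 0 < g.len y)
    (hA : ∀ k x, ‖A k x‖ ≤ α₁ * (g.len (blk x))⁻¹) (hAτB : ∀ ν k x, ‖tauB T U ν (A k) x‖ ≤ α₁ * (g.len (blk x))⁻¹)
    (hAτF : ∀ μ k x, ‖tauF T U μ (A k) x‖ ≤ α₁ * (g.len (blk x))⁻¹)
    (hU1 : ∀ μ x, ‖((U μ x : 𝔸ˣ) : 𝔸)‖ ≤ 1 ∧ ‖(((U μ x)⁻¹ : 𝔸ˣ) : 𝔸)‖ ≤ 1)
    (hd₀B : ∀ μ x, g.dist (blk x) (blk ((T μ).symm x)) ≤ d₀) (hd₀F : ∀ μ x, g.dist (blk x) (blk (T μ x)) ≤ d₀)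
    (hd₀0 : ∀ y : g.Site, g.dist y y ≤ d₀) (k : κ ⊕ κ) :
    ∀ (z' : (κ × S) × ι) (y'' : g.Site),
      (∑ z ∈ Finset.univ.filter (fun z : (κ × S) × ι => blk z.1.2 = y''), |conj b (V1Letter T U A k + V1Letter₂ T U A k) (Pi.single z' 1) z|) ≤
        (Fintype.card κ * n * Fintype.card ι : ℝ) * ((14 * (Fintype.card κ + 1) * M₂ * (∑ i, ‖b i‖) * Real.exp (δ * d₀)) * α₁ * (g.len y'')⁻¹ *
          Real.exp (-(δ * g.dist y'' (blk z'.1.2)))) := by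
  have hK := hasMajorant_V₃_one (Rr := 0) (H := True) b T U blk A d₀ δ M₂ α₁ hα₁ hδ hM₂ hrepr hlen hA hAτB hAτF hU1 hd₀B hd₀F hd₀0 k
  rw [← conj_add] at hK
  have hsub : ∀ z z', z' ∈ N₁ z → z' ∈ N z := fun z z' h => hN _ _ _ (hN₁0 _) h
  exact col_conj_of_hasMajorant_local (Rr := 0) (H := True) b blk N n hsymm hcard _
    (loc_mono (hsub := hsub) (loc_V1 T U A N₁ hN₁0 hN₁F hN₁B k))
    (fun a a' => by have := hlen a; positivity) hK

/-- **COLUMN BOUND OF THE ZEROTH-ORDER REMAINDER `C″ = V₃(A) − Σ_k∇_kV¹_k = V⁰ + Σ_k[V¹_k, ∇_k]`** ((3.73) zeroth-order size + the commutator sizes,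
read entrywise): `Σ_{z∈Δ(y″)}|(C″δ_{z′})(z)| ≦ (#κ·n·#ι)·(c⁰_V(d,α₁,C₀) + 2d·c_K(d,C₀))M₂(Σ‖b_i‖)e^{δd₀}·α₁(Lʲ″η)⁻²·e^{−δd(y″,y′)}` — majorants
`hasMajorant_V₃_zero` + `hasMajorant_comm_V₃_one` (through `hasMajorant_C₃_of_comm_sum`) + locality `loc_Cpp` through §1.
[cite: Balaban1985BackgroundPropagators, (3.73) p.405 + (3.82) p.407 + (3.71) pp.404–405 + (3.75) p.405 + (3.35)/(3.37) p.396; Balaban1984PropagatorsII, (2.51)–(2.52) p.232 (bookkeeping ours)] -/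
theorem col_Cpp (blk : S → g.Site) (hη : 0 < g.eta) (hL : 1 ≤ g.L) (A : κ → S → 𝔸) (C₀ d₀ δ M₂ α₁ : ℝ) (N₁ N : S → Finset S) (n : ℕ)
    (hN₁0 : ∀ z, z ∈ N₁ z) (hN₁F : ∀ a z, T a z ∈ N₁ z) (hN₁B : ∀ a z, (T a).symm z ∈ N₁ z)
    (hN : ∀ z z' z'', z' ∈ N₁ z → z'' ∈ N₁ z' → z'' ∈ N z)
    (hsymm : ∀ z z' : S, z' ∈ N z → z ∈ N z') (hcard : ∀ z, (N z).card ≤ n)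
    (hα₁ : 0 ≤ α₁) (hC₀ : 0 ≤ C₀) (hδ : 0 ≤ δ) (hM₂ : 0 ≤ M₂) (hrepr : ∀ (v : 𝔸) (i : ι), |b.repr v i| ≤ M₂ * ‖v‖)
    (hlen : ∀ y : g.Site, 0 < g.len y) (hsmall : ∀ y : g.Site, g.eta * (α₁ * (g.len y)⁻¹) ≤ 1 / 4)
    (hT : ∀ (μ ν : κ) (x : S), T μ (T ν x) = T ν (T μ x))
    (hU1 : ∀ m z, ‖((U m z : 𝔸ˣ) : 𝔸)‖ ≤ 1 ∧ ‖(((U m z)⁻¹ : 𝔸ˣ) : 𝔸)‖ ≤ 1)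
    -- (3.37) for the exponent field, blockwise, in the shapes the cited majorant files read it
    (hA : ∀ k x, ‖A k x‖ ≤ α₁ * (g.len (blk x))⁻¹)
    (hAτB : ∀ ν k x, ‖tauB T U ν (A k) x‖ ≤ α₁ * (g.len (blk x))⁻¹)
    (hAτF : ∀ μ k x, ‖tauF T U μ (A k) x‖ ≤ α₁ * (g.len (blk x))⁻¹)
    (hAFB : ∀ k μ ν x, ‖A k ((T ν).symm (T μ x))‖ ≤ α₁ * (g.len (blk x))⁻¹)
    (h337B : ∀ ν k x, ‖((g.eta : ℂ)⁻¹) • covDstar T U ν (A k) x‖ ≤ α₁ * (g.len (blk x) ^ 2)⁻¹)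
    (h337F : ∀ μ ν x, ‖((g.eta : ℂ)⁻¹) • covD T U μ (A ν) x‖ ≤ α₁ * (g.len (blk x) ^ 2)⁻¹)
    (h337B' : ∀ μ ν x, ‖((g.eta : ℂ)⁻¹) • covDstar T U ν (A ν) (T μ x)‖ ≤ α₁ * (g.len (blk x) ^ 2)⁻¹)
    (h337Bτ : ∀ μ x, ‖((g.eta : ℂ)⁻¹) • covDstar T U μ (tauB T U μ (A μ)) x‖ ≤ α₁ * (g.len (blk x) ^ 2)⁻¹)
    (h337FB : ∀ μ ν k x, ‖((g.eta : ℂ)⁻¹) • covD T U μ (A k) ((T ν).symm x)‖ ≤ α₁ * (g.len (blk x) ^ 2)⁻¹)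
    (hAst : ∀ μ x m z, (m, z) ∈ stBonds T μ x → ‖A m z‖ ≤ α₁ * (g.len (blk x))⁻¹)
    (hAloc : ∀ μ x m z, (m, z) ∈ B9Eq375Locality.locBondsA T μ x → ‖A m z‖ ≤ α₁ * (g.len (blk x))⁻¹)
    (hdAst : ∀ μ x m n y, Through T μ x m n y →
      ‖covD T U m (A n) y‖ ≤ g.eta * (α₁ * ((g.len (blk x))⁻¹) ^ 2) ∧
        ‖covD T U n (A m) y‖ ≤ g.eta * (α₁ * ((g.len (blk x))⁻¹) ^ 2))
    -- (3.35) on the plaquettes through / adjacent to the output bond, at the output block's scale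
    (h35 : ∀ μ x m n y, Through T μ x m n y → ‖(plaqU T U m n y : 𝔸) - 1‖ ≤ C₀ * ((g.L ^ g.scale (blk x))⁻¹) ^ 2)
    (h35' : ∀ m n x, ‖(plaqU T U m n ((T n).symm x) : 𝔸) - 1‖ ≤ C₀ * ((g.L ^ g.scale (blk x))⁻¹) ^ 2)
    -- stencil geometry
    (hd₀B : ∀ μ x, g.dist (blk x) (blk ((T μ).symm x)) ≤ d₀) (hd₀F : ∀ μ x, g.dist (blk x) (blk (T μ x)) ≤ d₀)
    (hd₀FB : ∀ μ ν x, g.dist (blk x) (blk ((T ν).symm (T μ x))) ≤ d₀)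
    (hd₀st : ∀ μ x (q : κ × S), q ∈ stBonds T μ x → g.dist (blk x) (blk q.2) ≤ d₀)
    (hd₀loc : ∀ μ x (q : κ × S), q ∈ B9Eq375Locality.locBondsA' T μ x → g.dist (blk x) (blk q.2) ≤ d₀)
    (hd₀0 : ∀ y : g.Site, g.dist y y ≤ d₀) :
    ∀ (z' : (κ × S) × ι) (y'' : g.Site),
      (∑ z ∈ Finset.univ.filter (fun z : (κ × S) × ι => blk z.1.2 = y''),
        |conj b (V₃Op T U g.eta A - ∑ k : κ ⊕ κ, diffLetter (bT T) (bU U) ((g.eta : ℂ)⁻¹) k * (V1Letter T U A k + V1Letter₂ T U A k))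
          (Pi.single z' 1) z|) ≤
        (Fintype.card κ * n * Fintype.card ι : ℝ) *
          (((cV0 (Fintype.card κ) α₁ C₀ + 2 * Fintype.card κ * (10 + 8 * Fintype.card κ + (16 * Fintype.card κ + 12) * C₀)) * M₂ * (∑ i, ‖b i‖) *
              Real.exp (δ * d₀)) * α₁ * (g.len y'' ^ 2)⁻¹ * Real.exp (-(δ * g.dist y'' (blk z'.1.2)))) := by
  classical
  -- abbreviations for the real-coordinate letters
  set D : κ ⊕ κ → Module.End ℝ ((κ × S) × ι → ℝ) := fun k => conj b (diffLetter (bT T) (bU U) ((g.eta : ℂ)⁻¹) k) with hD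
  set V1 : κ ⊕ κ → Module.End ℝ ((κ × S) × ι → ℝ) := fun k => conj b (V1Letter T U A k) + conj b (V1Letter₂ T U A k) with hV1
  set V0 : Module.End ℝ ((κ × S) × ι → ℝ) :=
    conj b (B9Eq371GradLetters.zeroLetter T U ((g.eta : ℂ)⁻¹) A + B9Eq372RemLetters.F₁Letter T U g.eta A)
      - conj b (B9Eq382V3Letters.dPrimeLetter T (prodCfg U g.eta A) g.eta - B9Eq382V3Letters.dPrimeLetter T U g.eta)
      + conj b (B9Eq375GradLetters.zeroLetter₂ T U ((g.eta : ℂ)⁻¹) A + B9Eq372RemLetters.F₂Letter T U g.eta A) with hV0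
  -- the gradient form after coordinates, and the letter of this theorem as `V⁰ + Σ_k [V¹_k, ∇_k]`
  have hgrad : conj b (V₃Op T U g.eta A) = V0 + ∑ k ∈ Finset.univ, V1 k * D k := conj_V₃Op_eq_gradForm T U b g.eta A
  have hop : conj b (V₃Op T U g.eta A - ∑ k : κ ⊕ κ, diffLetter (bT T) (bU U) ((g.eta : ℂ)⁻¹) k * (V1Letter T U A k + V1Letter₂ T U A k))
      = V0 + ∑ k ∈ Finset.univ, (V1 k * D k - D k * V1 k) := by
    rw [conj_sub, conj_finset_sum, hgrad]
    simp only [B9Eq352DivFormLetters.conj_mul, conj_add, hV1, hD]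
    rw [Finset.sum_sub_distrib]
    abel
  -- the majorant of `V⁰ + Σ_k [V¹_k, ∇_k]`
  have hV0M := hasMajorant_V₃_zero (Rr := 0) (H := True) b T U blk hη hL A C₀ d₀ δ M₂ α₁ hα₁ hC₀ hδ hM₂ hrepr hlen hsmall hU1 h337B h337F
    h337B' hAst hAloc hdAst h35 hd₀B hd₀F hd₀FB hd₀st hd₀loc hd₀0
  have hCommM : ∀ k ∈ (Finset.univ : Finset (κ ⊕ κ)), HasMajorant (g := toB6 g 0 True) (fun q : (κ × S) × ι => blk q.1.2)
      (V1 k * D k - D k * V1 k)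
      (fun y y' => ((10 + 8 * Fintype.card κ + (16 * Fintype.card κ + 12) * C₀) * M₂ * (∑ i, ‖b i‖) * Real.exp (δ * d₀)) *
        α₁ * (g.len y ^ 2)⁻¹ * Real.exp (-(δ * g.dist y y'))) := fun k _ =>
    hasMajorant_comm_V₃_one (Rr := 0) (H := True) b T U blk hη hL A C₀ d₀ δ M₂ α₁ hα₁ hC₀ hδ hM₂ hrepr hT hU1 hA hAτB hAτF hAFB h337F
      h337B h337B' h337Bτ h337FB h35' hd₀B hd₀F hd₀FB k
  have hM := hasMajorant_C₃_of_comm_sum (R := 0) (H := True) (fun q : (κ × S) × ι => blk q.1.2) Finset.univ δ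
    (cV0 (Fintype.card κ) α₁ C₀ * M₂ * (∑ i, ‖b i‖) * Real.exp (δ * d₀)) α₁
    (fun _ => (10 + 8 * Fintype.card κ + (16 * Fintype.card κ + 12) * C₀) * M₂ * (∑ i, ‖b i‖) * Real.exp (δ * d₀)) hV0M hCommM
  rw [← hop] at hM
  have hbsum : 0 ≤ ∑ i, ‖b i‖ := Finset.sum_nonneg fun i _ => norm_nonneg _
  have hcK : 0 ≤ (10 + 8 * Fintype.card κ + (16 * Fintype.card κ + 12) * C₀) := by positivity
  have hcV : 0 ≤ cV0 (Fintype.card κ) α₁ C₀ := by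
    have h1 : 0 ≤ B9Eq372RemLetters.growth (1 / 4) := by unfold B9Eq372RemLetters.growth; positivity
    have h2 := B9Eq382V3Operator.kΔ_nonneg hα₁ hC₀
    unfold cV0; positivity
  have hM' : HasMajorant (g := toB6 g 0 True) (fun q : (κ × S) × ι => blk q.1.2)
      (conj b (V₃Op T U g.eta A - ∑ k : κ ⊕ κ, diffLetter (bT T) (bU U) ((g.eta : ℂ)⁻¹) k * (V1Letter T U A k + V1Letter₂ T U A k)))
      (fun y y' => ((cV0 (Fintype.card κ) α₁ C₀ + 2 * Fintype.card κ * (10 + 8 * Fintype.card κ + (16 * Fintype.card κ + 12) * C₀)) * M₂ *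
          (∑ i, ‖b i‖) * Real.exp (δ * d₀)) * α₁ * (g.len y ^ 2)⁻¹ * Real.exp (-(δ * g.dist y y'))) := by
    refine hasMajorant_mono (g := toB6 g 0 True) _ hM fun y y' => le_of_eq ?_
    simp only [Finset.sum_const, Finset.card_univ, Fintype.card_sum, nsmul_eq_mul, Nat.cast_add]
    ring
  exact col_conj_of_hasMajorant_local (Rr := 0) (H := True) b blk N n hsymm hcard _
    (loc_Cpp T U A hη.ne' hN₁0 hN₁F hN₁B hN) (fun a a' => by positivity) hM'

end Columns

/-! ## §4  The kernel of `X·V₃(A)` — `V₃(A)` on the RIGHT of a kernel-bounded operator with right difference entries -/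

section KernelRight

variable {𝔸 : Type*} [NormedRing 𝔸] [NormedAlgebra ℂ 𝔸] [CompleteSpace 𝔸] {ι : Type} [Fintype ι] [DecidableEq ι] (b : Module.Basis ι ℝ 𝔸)
variable {S : Type} [Fintype S] [DecidableEq S] {κ : Type} [Fintype κ] [LinearOrder κ]
variable (T : κ → Equiv.Perm S) (U : κ → S → 𝔸ˣ)
variable {g : B9.Geometry} [Fintype g.Site] [DecidableEq g.Site] {Rr : ℝ} {H : Prop}

set_option maxHeartbeats 1600000 in
/-- **THE KERNEL OF `X·V₃(A)`, `V₃(A)` ON THE RIGHT** (p. 407: in `G(U′U) = G(U) + G(U′U)V(A)G(U)` ((3.84)–(3.86), `B9Thm34HolderInputG.resolvent_right`)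
the remainder's left factor `G(U′U)V(A)` carries `V(A)` on the right of the kernel-bounded `G(U′U)`; here its LOCAL part `V₃(A)` of (3.82)).  For an
operator `X` on the bond carrier with the kernel bounds `|X(x,x′)| ≦ B_Xw_X(y)e^{−rd}v(y′)⁻¹` and `|(X∇_k)(x,x′)| ≦ B_Xw_X(y)(Lʲη)⁻¹e^{−rd}v(y′)⁻¹` for every
concrete bond difference `∇_k` (print: Theorem 3.3's (3.42)₁,₃ for `X = G(U′U)`, `w_X = (Lʲη)²`), the DIVERGENCE form `V₃ = Σ_k∇_kV¹_k + C″` of the concrete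
`V₃(A)` after coordinates, the COLUMN bounds of §3 (`V¹_k`: `α₁(Lʲη)⁻¹`; `C″`: `α₁(Lʲη)⁻²`, (3.73)/(3.35)/(3.37) read entrywise), the scale transfers of
`(Lʲη)⁻¹`, `(Lʲη)⁻²` at exponent `α`, of the block-volume weight `v⁻¹` at rate `γ` (`Λ_v`) and [4] (2.61) at `β` (`ρ + (α+β)δ₀ ≦ r`, columns at the rate
`ρ + γ`): `|(X·V₃(A))(x,x′)| ≦ Θ·α₁·w_X(y)(Lʲη)⁻²·e^{−ρd(y,y′)}·v(y′)⁻¹`, `Θ = Λ_vΛc₁(β)B_X·(#κ·n·#ι)·M₂(Σ‖b_i‖)e^{(ρ+γ)d₀}·(2d·14(d+1) + c⁰_V + 2d·c_K)`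
(«O(1)B₀α₁»).  Device: `X·V₃ = Σ_k(X∇_k)·V¹_k + X·C″` and FILE 41's «kernel × column ⟹ kernel».
[cite: Balaban1985BackgroundPropagators, (3.84)–(3.86) p.407 + p.403 l.7–9 + (3.82) p.407 + (3.73) p.405 + (3.35)/(3.37) p.396 + (3.42) p.397 + p.398 remark; Balaban1984PropagatorsII, (2.51)–(2.55) p.232 + Lemma 2.1 (2.61) p.234 + (2.64)–(2.66) p.234] -/
theorem hasKernelBound_mul_V₃_right (blk : S → g.Site) (d : ℕ) (hη : 0 < g.eta) (hL : 1 ≤ g.L) (A : κ → S → 𝔸)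
    (C₀ d₀ M₂ : ℝ) (N₁ N : S → Finset S) (n : ℕ)
    (δ₀ α β γ ρ r Λ Λv BX α₁ : ℝ) (wX : g.Site → ℝ) {v : g.Site → ℝ} (hv : ∀ y, 0 < v y) {cK : ℝ} (hcK : 0 < cK)
    (hBX : 0 ≤ BX) (hα₁ : 0 ≤ α₁) (hC₀ : 0 ≤ C₀) (hM₂ : 0 ≤ M₂) (hΛ : 0 ≤ Λ) (hΛv : 0 ≤ Λv) (hρ : 0 ≤ ρ) (hγ : 0 ≤ γ)
    (hr : ρ + (α + β) * δ₀ ≤ r)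
    (hdnn : ∀ a a' : g.Site, 0 ≤ g.dist a a') (htri : Triangle254 (toB6 g Rr H)) (hlen : ∀ y : g.Site, 0 < g.len y)
    (h261 : Ineq261 d (toB6 g Rr H) δ₀ β) (hwX : ∀ a, 0 ≤ wX a)
    (hT1i : ScaleTransfer g δ₀ α Λ (fun a => (g.len a)⁻¹)) (hT2i : ScaleTransfer g δ₀ α Λ (fun a => (g.len a ^ 2)⁻¹))
    (hTv : ∀ a a' : g.Site, Real.exp (-(γ * g.dist a a')) * (v a)⁻¹ ≤ Λv * (v a')⁻¹)
    -- the stencil system of §1 (concrete instance: `nbhd₁_*`, `nbhd₂_*`)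
    (hN₁0 : ∀ z, z ∈ N₁ z) (hN₁F : ∀ a z, T a z ∈ N₁ z) (hN₁B : ∀ a z, (T a).symm z ∈ N₁ z)
    (hN : ∀ z z' z'', z' ∈ N₁ z → z'' ∈ N₁ z' → z'' ∈ N z)
    (hsymm : ∀ z z' : S, z' ∈ N z → z ∈ N z') (hcard : ∀ z, (N z).card ≤ n)
    -- real coordinates, commuting translations, group-valued background, `ηα₁(Lʲη)⁻¹ ≦ 1/4`
    (hrepr : ∀ (v : 𝔸) (i : ι), |b.repr v i| ≤ M₂ * ‖v‖) (hsmall : ∀ y : g.Site, g.eta * (α₁ * (g.len y)⁻¹) ≤ 1 / 4)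
    (hT : ∀ (μ ν : κ) (x : S), T μ (T ν x) = T ν (T μ x))
    (hU1 : ∀ m z, ‖((U m z : 𝔸ˣ) : 𝔸)‖ ≤ 1 ∧ ‖(((U m z)⁻¹ : 𝔸ˣ) : 𝔸)‖ ≤ 1)
    -- (3.37) for the exponent field, blockwise, in the shapes the gen-11 majorant files read it
    (hA : ∀ k x, ‖A k x‖ ≤ α₁ * (g.len (blk x))⁻¹)
    (hAτB : ∀ ν k x, ‖tauB T U ν (A k) x‖ ≤ α₁ * (g.len (blk x))⁻¹)
    (hAτF : ∀ μ k x, ‖tauF T U μ (A k) x‖ ≤ α₁ * (g.len (blk x))⁻¹)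
    (hAFB : ∀ k μ ν x, ‖A k ((T ν).symm (T μ x))‖ ≤ α₁ * (g.len (blk x))⁻¹)
    (h337B : ∀ ν k x, ‖((g.eta : ℂ)⁻¹) • covDstar T U ν (A k) x‖ ≤ α₁ * (g.len (blk x) ^ 2)⁻¹)
    (h337F : ∀ μ ν x, ‖((g.eta : ℂ)⁻¹) • covD T U μ (A ν) x‖ ≤ α₁ * (g.len (blk x) ^ 2)⁻¹)
    (h337B' : ∀ μ ν x, ‖((g.eta : ℂ)⁻¹) • covDstar T U ν (A ν) (T μ x)‖ ≤ α₁ * (g.len (blk x) ^ 2)⁻¹)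
    (h337Bτ : ∀ μ x, ‖((g.eta : ℂ)⁻¹) • covDstar T U μ (tauB T U μ (A μ)) x‖ ≤ α₁ * (g.len (blk x) ^ 2)⁻¹)
    (h337FB : ∀ μ ν k x, ‖((g.eta : ℂ)⁻¹) • covD T U μ (A k) ((T ν).symm x)‖ ≤ α₁ * (g.len (blk x) ^ 2)⁻¹)
    (hAst : ∀ μ x m z, (m, z) ∈ stBonds T μ x → ‖A m z‖ ≤ α₁ * (g.len (blk x))⁻¹)
    (hAloc : ∀ μ x m z, (m, z) ∈ B9Eq375Locality.locBondsA T μ x → ‖A m z‖ ≤ α₁ * (g.len (blk x))⁻¹)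
    (hdAst : ∀ μ x m n y, Through T μ x m n y →
      ‖covD T U m (A n) y‖ ≤ g.eta * (α₁ * ((g.len (blk x))⁻¹) ^ 2) ∧
        ‖covD T U n (A m) y‖ ≤ g.eta * (α₁ * ((g.len (blk x))⁻¹) ^ 2))
    -- (3.35) on the plaquettes through / adjacent to the output bond, at the output block's scale
    (h35 : ∀ μ x m n y, Through T μ x m n y → ‖(plaqU T U m n y : 𝔸) - 1‖ ≤ C₀ * ((g.L ^ g.scale (blk x))⁻¹) ^ 2)
    (h35' : ∀ m n x, ‖(plaqU T U m n ((T n).symm x) : 𝔸) - 1‖ ≤ C₀ * ((g.L ^ g.scale (blk x))⁻¹) ^ 2)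
    -- stencil geometry
    (hd₀B : ∀ μ x, g.dist (blk x) (blk ((T μ).symm x)) ≤ d₀) (hd₀F : ∀ μ x, g.dist (blk x) (blk (T μ x)) ≤ d₀)
    (hd₀FB : ∀ μ ν x, g.dist (blk x) (blk ((T ν).symm (T μ x))) ≤ d₀)
    (hd₀st : ∀ μ x (q : κ × S), q ∈ stBonds T μ x → g.dist (blk x) (blk q.2) ≤ d₀)
    (hd₀loc : ∀ μ x (q : κ × S), q ∈ B9Eq375Locality.locBondsA' T μ x → g.dist (blk x) (blk q.2) ≤ d₀)
    (hd₀0 : ∀ y : g.Site, g.dist y y ≤ d₀)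
    -- the left factor: kernel bounds of `X` and of its right entries `X∇_k`
    {X : Module.End ℝ ((κ × S) × ι → ℝ)}
    (hX : HasKernelBound (g := toB6 g Rr H) (fun q : (κ × S) × ι => blk q.1.2) v cK X (fun a a' => BX * wX a * Real.exp (-(r * g.dist a a'))))
    (hXD : ∀ k : κ ⊕ κ, HasKernelBound (g := toB6 g Rr H) (fun q : (κ × S) × ι => blk q.1.2) v cK
      (X * conj b (diffLetter (bT T) (bU U) ((g.eta : ℂ)⁻¹) k)) (fun a a' => BX * (wX a * (g.len a)⁻¹) * Real.exp (-(r * g.dist a a')))) :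
    HasKernelBound (g := toB6 g Rr H) (fun q : (κ × S) × ι => blk q.1.2) v cK (X * conj b (V₃Op T U g.eta A))
      (fun a a' => (Λv * Λ * B6.c1 d δ₀ β * BX * ((Fintype.card κ * n * Fintype.card ι) * (M₂ * (∑ i, ‖b i‖) * Real.exp ((ρ + γ) * d₀)) * α₁ *
          (2 * Fintype.card κ * (14 * (Fintype.card κ + 1))
            + (cV0 (Fintype.card κ) α₁ C₀ + 2 * Fintype.card κ * (10 + 8 * Fintype.card κ + (16 * Fintype.card κ + 12) * C₀))))) *
        (wX a * (g.len a ^ 2)⁻¹) * Real.exp (-(ρ * g.dist a a'))) := by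
  classical
  -- abbreviations
  set cN : ℝ := (Fintype.card κ * n * Fintype.card ι : ℝ) with hcN
  set cb : ℝ := M₂ * (∑ i, ‖b i‖) * Real.exp ((ρ + γ) * d₀) with hcb
  set c1 : ℝ := 14 * (Fintype.card κ + 1) with hc1
  set cZ : ℝ := cV0 (Fintype.card κ) α₁ C₀ + 2 * Fintype.card κ * (10 + 8 * Fintype.card κ + (16 * Fintype.card κ + 12) * C₀) with hcZ
  set D : κ ⊕ κ → Module.End ℝ ((κ × S) × ι → ℝ) := fun k => conj b (diffLetter (bT T) (bU U) ((g.eta : ℂ)⁻¹) k) with hD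
  set V1 : κ ⊕ κ → Module.End ℝ ((κ × S) × ι → ℝ) := fun k => conj b (V1Letter T U A k + V1Letter₂ T U A k) with hV1
  set Cpp : Module.End ℝ ((κ × S) × ι → ℝ) :=
    conj b (V₃Op T U g.eta A - ∑ k : κ ⊕ κ, diffLetter (bT T) (bU U) ((g.eta : ℂ)⁻¹) k * (V1Letter T U A k + V1Letter₂ T U A k)) with hCpp
  have hbsum : 0 ≤ ∑ i, ‖b i‖ := Finset.sum_nonneg fun i _ => norm_nonneg _
  have hcN0 : 0 ≤ cN := by rw [hcN]; positivity
  have hcb0 : 0 ≤ cb := by rw [hcb]; positivity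
  have hc10 : 0 ≤ c1 := by rw [hc1]; positivity
  have hcZ0 : 0 ≤ cZ := by
    have h1 : 0 ≤ B9Eq372RemLetters.growth (1 / 4) := by unfold B9Eq372RemLetters.growth; positivity
    have h2 := B9Eq382V3Operator.kΔ_nonneg hα₁ hC₀
    rw [hcZ]; unfold cV0; positivity
  have hργ : 0 ≤ ρ + γ := add_nonneg hρ hγ
  -- the divergence form after coordinates: `X·V₃ = Σ_k (X∇_k)·V¹_k + X·C″`
  have hdiv : conj b (V₃Op T U g.eta A) = ∑ k ∈ Finset.univ, D k * V1 k + Cpp := by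
    rw [hCpp, conj_sub, conj_finset_sum]
    simp only [B9Eq352DivFormLetters.conj_mul, hD, hV1]
    abel
  have hop : X * conj b (V₃Op T U g.eta A) = ∑ k ∈ Finset.univ, X * D k * V1 k + X * Cpp := by
    rw [hdiv, mul_add, Finset.mul_sum]
    simp only [mul_assoc]
  -- the columns of §3 at the rate `ρ + γ`
  have colV1 : ∀ k : κ ⊕ κ, ∀ (z' : (κ × S) × ι) (y'' : g.Site),
      (∑ z ∈ Finset.univ.filter (fun z : (κ × S) × ι => blk z.1.2 = y''), |V1 k (Pi.single z' 1) z|) ≤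
        (cN * cb * c1 * α₁) * (g.len y'')⁻¹ * Real.exp (-((ρ + γ) * g.dist y'' (blk z'.1.2))) := by
    intro k z' y''
    refine (col_V1 b T U blk A d₀ (ρ + γ) M₂ α₁ N₁ N n hN₁0 hN₁F hN₁B hN hsymm hcard hα₁ hργ hM₂ hrepr hlen hA hAτB
      hAτF hU1 hd₀B hd₀F hd₀0 k z' y'').trans (le_of_eq ?_)
    rw [hcN, hcb, hc1]; ring
  have colCpp : ∀ (z' : (κ × S) × ι) (y'' : g.Site),
      (∑ z ∈ Finset.univ.filter (fun z : (κ × S) × ι => blk z.1.2 = y''), |Cpp (Pi.single z' 1) z|) ≤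
        (cN * cb * cZ * α₁) * (g.len y'' ^ 2)⁻¹ * Real.exp (-((ρ + γ) * g.dist y'' (blk z'.1.2))) := by
    intro z' y''
    refine (col_Cpp b T U blk hη hL A C₀ d₀ (ρ + γ) M₂ α₁ N₁ N n hN₁0 hN₁F hN₁B hN hsymm hcard hα₁ hC₀ hργ hM₂ hrepr
      hlen hsmall hT hU1 hA hAτB hAτF hAFB h337B h337F h337B' h337Bτ h337FB hAst hAloc hdAst h35 h35' hd₀B hd₀F hd₀FB hd₀st hd₀loc hd₀0
      z' y'').trans (le_of_eq ?_)
    rw [hcN, hcb, hcZ]; ring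
  -- kernel × column, term by term
  have hw₁ : ∀ a : g.Site, 0 ≤ wX a * (g.len a)⁻¹ := fun a => mul_nonneg (hwX a) (inv_nonneg.mpr (hlen a).le)
  have termV1 : ∀ k ∈ (Finset.univ : Finset (κ ⊕ κ)), HasKernelBound (g := toB6 g Rr H) (fun q : (κ × S) × ι => blk q.1.2) v cK
      (X * D k * V1 k)
      (fun a a' => (Λv * Λ * B6.c1 d δ₀ β * BX * (cN * cb * c1 * α₁)) * ((wX a * (g.len a)⁻¹) * (g.len a)⁻¹) *
        Real.exp (-(ρ * g.dist a a'))) := fun k _ =>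
    hasKernelBound_mul_col (R := Rr) (H := H) (fun q : (κ × S) × ι => blk q.1.2) hv hcK d (fun a => wX a * (g.len a)⁻¹)
      (fun a => (g.len a)⁻¹) hw₁ (fun a => inv_nonneg.mpr (hlen a).le) hBX (by positivity) hΛ hΛv hρ hr hdnn htri hT1i h261 hTv (hXD k)
      (colV1 k)
  have termCpp : HasKernelBound (g := toB6 g Rr H) (fun q : (κ × S) × ι => blk q.1.2) v cK (X * Cpp)
      (fun a a' => (Λv * Λ * B6.c1 d δ₀ β * BX * (cN * cb * cZ * α₁)) * (wX a * (g.len a ^ 2)⁻¹) * Real.exp (-(ρ * g.dist a a'))) :=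
    hasKernelBound_mul_col (R := Rr) (H := H) (fun q : (κ × S) × ι => blk q.1.2) hv hcK d wX (fun a => (g.len a ^ 2)⁻¹) hwX
      (fun a => inv_nonneg.mpr (sq_nonneg _)) hBX (by positivity) hΛ hΛv hρ hr hdnn htri hT2i h261 hTv hX colCpp
  have hsum := hasKernelBound_finset_sum (R := Rr) (H := H) (fun q : (κ × S) × ι => blk q.1.2) Finset.univ (fun k => X * D k * V1 k) _ termV1
  have hall := hasKernelBound_add (g := toB6 g Rr H) (fun q : (κ × S) × ι => blk q.1.2) hsum termCpp
  rw [hop]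
  refine hasKernelBound_mono (g := toB6 g Rr H) _ hv hall fun a a' => le_of_eq ?_
  have hl : (g.len a)⁻¹ * (g.len a)⁻¹ = (g.len a ^ 2)⁻¹ := by rw [pow_two, mul_inv]
  simp only [Finset.sum_const, Finset.card_univ, Fintype.card_sum, nsmul_eq_mul, Nat.cast_add]
  rw [mul_assoc (wX a) ((g.len a)⁻¹) ((g.len a)⁻¹), hl, hcN, hcb, hc1, hcZ]
  ring

end KernelRight

end Literature.MathematicalPhysics.QuantumFieldTheory.Balaban1983to89.B9Ineq385V3RightKernel
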